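import Summits.ResolutionOfSingularities.ResolutionOfSingularities.Theorems.MarkedTransferCampaignW46WWalkLaws
import Summits.ResolutionOfSingularities.ResolutionOfSingularities.Theorems.MarkedTransferCampaignW46WWalkEndgame
import Summits.ResolutionOfSingularities.ResolutionOfSingularities.Theorems.MarkedTransferCampaignW46MohWindowShadeDegreeLaw
import Summits.ResolutionOfSingularities.ResolutionOfSingularities.Theorems.MarkedTransferCampaignW46MohWindowShadeFormalNRChart
import HarnessLib

/-!
# [OURS · L1 W4.6 rung (iii-2), NON-RATIONAL W-WALK, brick 1] The W-model under a coefficient map, the W-DEGREE LAW at a point of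
# degree `m`, and the one-variable algebra of defect persistence

Cell `res-hironaka`, LADDER-RESOLUTION rung L (D-0089), slot W4.6 rung (iii); seat res-L1-s46-pv-6 (gen 8). Host route MarkedTransfer,
`--supports stmt-ResolutionOfSingularities-16155 --as helper`; kind proof (no definition). Pure algebra over res-L1-s46-pv-5's coefficient
model `…WWalkModel` / `…WWalkLaws` (`chartT`, `shearZ`, `stepT`, `swapTY`, `BDiv`, `LowVanish`, `NDz`, `layerP`, `pcoef`) — the pieces the
NON-RATIONAL W-walk (o1's regime of record `MohWindowSurfaceInsepPermissiblyTerminates p K` over a PERFECT, not algebraically closed,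
ground field) adds to pv-5's programme (`HOME/L/res-L1-s46-pv-5/W-WALK-PLAN.md`, closed over `K̄` in p563520):

* §1 `chartT_map`, `shearZ_map`, `stepT_map`, `swapTY_map` — the model commutes with `MvPowerSeries.map ι` (the model of the thread is run in
  `Ω⟦t,y,z⟧`, `Ω` algebraically closed, while the anchors live over the residue fields `L_k ↪ Ω`); `lowVanish_map_iff`, `bdiv_map_iff`,
  `ndz_map_iff`.
* §2 THE W-DEGREE LAW `exists_coeff_stepT_ne_zero_of_root`: if `f = f₀ ⊗_ι K`, `BDiv r_t r_y f₀`, `LowVanish d f₀`, `p+1 ≤ d ≤ 2p−1`, and the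
  `T`-step is taken at `l ≠ 0`, a root of `π^ι` with `π ∈ K₀[X]` irreducible separable of degree `m`, then every NONZERO `z^c`-column of the
  degree-`d` layer of `f₀` yields a monomial `t^{d−p} y^k z^c` of `stepT p l γ f` with `m·k + c ≤ σ = d − r_t − r_y`: the column polynomial
  `Φ_c = Σ_b φ(d−b−c, b, c) X^b ∈ K₀[X]` has `X^{r_y}·(π^ι)^k ∣ Φ_c^ι` for `k` its multiplicity at `l` (this seat's gen-7
  `pow_dvd_map_of_rootMultiplicity`), and `layerP d l f k c` is the `k`-th Taylor coefficient of `Φ_c^ι` at `l` (pv-5's `coeff_stepT_layer`).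
  With (ND) (`c = 0`): `m · σ′ ≤ σ` (`natDegree_mul_shade_le`) — a NON-RATIONAL step (`m ≥ 2`) at least halves the shade.
* §3 `eq_zero_of_taylor_coeff_eq_zero` — a column all of whose Taylor coefficients at `l` below index `N` vanish, of degree `≤ N` and with
  vanishing `X^N`-coefficient, is zero — the algebra of DEFECT PERSISTENCE on the `σ = p` plateau, assembled in `coeff_eq_zero_of_layer_of_stall`
  (with pv-5's `pcoef_eq_zero_of_stall`); `pcoef_zero_eq_layerP`, `pcoef_zero_eq_sum`.
(The UNIT TWIST of the plateau argument is the sibling file `…WWalkNRTwist`.)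

HONEST FRAMING. OURS; nothing here is a statement of H. Hironaka's manuscript [Hironaka2017] and nothing of it is used. AI-written;
AI review is weaker than expert review. No `sorry`; axioms standard. Chart formulas as in H. Hauser, Bull. AMS 47 (2010) §§F–G
[Hauser2010]; [folklore].
-/

noncomputable section

set_option linter.dupNamespace false -- mandated namespace of this single-conjunct summit

open MvPowerSeries Finset

namespace Summit.ResolutionOfSingularities.ResolutionOfSingularities.Theorems

namespace CampaignW46

namespace WWalkNR

open WWalk
open MohWindowShadeDegreeLaw (pow_dvd_map_of_rootMultiplicity)
open MohWindowShadeAdapted (taylor_coeff_sum_C_mul_X_pow)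

/-! ## §1 The model under a coefficient map -/

section Map

variable {K K' : Type*} [Field K] [Field K'] (ι : K →+* K')

/-- `chartT` commutes with coefficient maps. [cite: Hauser2010, §F] -/
theorem chartT_map (p : ℕ) (l : K) (f : MvPowerSeries (Option (Fin 2)) K) :
    MvPowerSeries.map ι (chartT p l f) = chartT p (ι l) (MvPowerSeries.map ι f) := by
  ext e
  rw [MvPowerSeries.coeff_map, ← mk3_eta e, coeff_chartT, coeff_chartT, map_sum]
  refine sum_congr rfl fun b _ => ?_
  split_ifs
  · rw [map_mul, map_mul, map_natCast, map_pow, MvPowerSeries.coeff_map]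
  · rw [map_zero]

/-- `shearZ` commutes with coefficient maps. [folklore] -/
theorem shearZ_map (γ : K) (f : MvPowerSeries (Option (Fin 2)) K) :
    MvPowerSeries.map ι (shearZ γ f) = shearZ (ι γ) (MvPowerSeries.map ι f) := by
  ext e
  rw [MvPowerSeries.coeff_map, ← mk3_eta e, coeff_shearZ, coeff_shearZ, map_sum]
  refine sum_congr rfl fun i _ => ?_
  rw [map_mul, map_mul, map_natCast, map_pow, map_neg, MvPowerSeries.coeff_map]

/-- **`stepT` commutes with coefficient maps**: the model step of the base-changed residual is the base change of the model step. [cite: Hauser2010, §§F–G] -/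
theorem stepT_map (p : ℕ) (l γ : K) (f : MvPowerSeries (Option (Fin 2)) K) :
    MvPowerSeries.map ι (stepT p l γ f) = stepT p (ι l) (ι γ) (MvPowerSeries.map ι f) := by
  rw [stepT, stepT, shearZ_map, map_sub, chartT_map, map_mul, map_pow (MvPowerSeries.map ι), MvPowerSeries.map_X,
    MvPowerSeries.map_C, map_pow ι]

/-- `swapTY` commutes with coefficient maps. [folklore] -/
theorem swapTY_map (f : MvPowerSeries (Option (Fin 2)) K) :
    MvPowerSeries.map ι (swapTY f) = swapTY (MvPowerSeries.map ι f) := by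
  ext e
  rw [MvPowerSeries.coeff_map, ← mk3_eta e, coeff_swapTY, coeff_swapTY, MvPowerSeries.coeff_map]

/-- `LowVanish` is invariant under an injective coefficient map. [folklore] -/
theorem lowVanish_map_iff (n : ℕ) (f : MvPowerSeries (Option (Fin 2)) K) :
    LowVanish n (MvPowerSeries.map ι f) ↔ LowVanish n f := by
  refine ⟨fun h e he => ?_, fun h e he => ?_⟩
  · have h1 := h e he
    rw [MvPowerSeries.coeff_map, map_eq_zero_iff ι ι.injective] at h1
    exact h1
  · rw [MvPowerSeries.coeff_map, h e he, map_zero]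

/-- `BDiv` is invariant under an injective coefficient map. [folklore] -/
theorem bdiv_map_iff (rt ry : ℕ) (f : MvPowerSeries (Option (Fin 2)) K) :
    BDiv rt ry (MvPowerSeries.map ι f) ↔ BDiv rt ry f := by
  refine ⟨fun h e he => h e ?_, fun h e he => h e ?_⟩
  · rw [MvPowerSeries.coeff_map, map_ne_zero_iff ι ι.injective]; exact he
  · rw [MvPowerSeries.coeff_map, map_ne_zero_iff ι ι.injective] at he; exact he

/-- (ND) is invariant under an injective coefficient map. [folklore] -/
theorem ndz_map_iff (d : ℕ) (f : MvPowerSeries (Option (Fin 2)) K) :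
    NDz d (MvPowerSeries.map ι f) ↔ NDz d f := by
  constructor
  · rintro ⟨a, b, hab, h⟩
    rw [MvPowerSeries.coeff_map, map_ne_zero_iff ι ι.injective] at h
    exact ⟨a, b, hab, h⟩
  · rintro ⟨a, b, hab, h⟩
    exact ⟨a, b, hab, by rw [MvPowerSeries.coeff_map, map_ne_zero_iff ι ι.injective]; exact h⟩

/-- A series all of whose coefficients lie in the image of `ι` is a base change. [folklore] -/
theorem exists_eq_map_of_coeff_mem (g : MvPowerSeries (Option (Fin 2)) K') (hg : ∀ e, coeff e g ∈ ι.fieldRange) :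
    ∃ g₀ : MvPowerSeries (Option (Fin 2)) K, MvPowerSeries.map ι g₀ = g := by
  choose a ha using hg
  exact ⟨fun e => a e, by ext e; rw [MvPowerSeries.coeff_map]; exact ha e⟩

/-- The coefficients of a base change lie in the image. [folklore] -/
theorem coeff_map_mem (f : MvPowerSeries (Option (Fin 2)) K) (e : Option (Fin 2) →₀ ℕ) :
    coeff e (MvPowerSeries.map ι f) ∈ ι.fieldRange := by
  rw [MvPowerSeries.coeff_map]; exact ⟨_, rfl⟩

end Map

/-! ## §2 The W-degree law -/

section DegreeLaw

variable {K₀ K : Type*} [Field K₀] [Field K] (ι : K₀ →+* K)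

/-- **The layer coefficient is a Taylor coefficient of the column polynomial**: with `Φ_c = Σ_{b : b + c ≤ d} φ(d−b−c, b, c) X^b`,
`layerP d l f k c = (taylor l Φ_c).coeff k`. [folklore] -/
theorem layerP_eq_taylor_coeff (d : ℕ) (l : K) (f : MvPowerSeries (Option (Fin 2)) K) (k c : ℕ) :
    layerP d l f k c = (Polynomial.taylor l (∑ b ∈ (range (d + 1)).filter (fun b => b + c ≤ d),
      Polynomial.C (coeff (mk3 (d - b - c) b c) f) * Polynomial.X ^ b)).coeff k := by
  rw [taylor_coeff_sum_C_mul_X_pow, layerP, sum_filter]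
  refine sum_congr rfl fun b _ => ?_
  split_ifs
  · ring
  · rfl

/-- `pcoef` with no `y`-letter is the layer coefficient. [folklore] -/
theorem pcoef_zero_eq_layerP (d : ℕ) (l : K) (f : MvPowerSeries (Option (Fin 2)) K) (i c : ℕ) :
    pcoef 0 d l f i c = layerP d l f i c := by
  rw [pcoef, layerP]
  refine sum_congr rfl fun b _ => ?_
  simp only [Nat.zero_add, Nat.add_zero, Nat.sub_zero]

/-- **[OURS · L1 W4.6 rung (iii-2)] THE W-DEGREE LAW.** See the module docstring: at a `T`-step at `l ≠ 0`, a root of `π^ι` with `π`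
irreducible separable over `K₀` of degree `m`, a nonzero `z^c`-column of the degree-`d` layer of `f₀` gives a monomial `t^{d−p} y^k z^c` of the
transform with `m·k + c ≤ d − r_t − r_y`. NOT a statement of the manuscript. [cite: Hauser2010, §§F–G (point blowup followed by cleaning)] -/
theorem exists_coeff_stepT_ne_zero_of_root {p d rt ry : ℕ} (hpd : p + 1 ≤ d) (hd2 : d ≤ 2 * p - 1)
    {f₀ : MvPowerSeries (Option (Fin 2)) K₀} (hB : BDiv rt ry f₀) (hlow : LowVanish d f₀)
    {π : Polynomial K₀} (hirr : Irreducible π) (hsep : π.Separable) {l : K} (hl : (π.map ι).IsRoot l) (hl0 : l ≠ 0) (γ : K)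
    {c : ℕ} (hc : ∃ a b, a + b + c = d ∧ coeff (mk3 a b c) f₀ ≠ 0) :
    ∃ k, π.natDegree * k + c ≤ d - rt - ry ∧ coeff (mk3 (d - p) k c) (stepT p l γ (MvPowerSeries.map ι f₀)) ≠ 0 := by
  classical
  obtain ⟨a₀, b₀, hab₀, hne₀⟩ := hc
  have hbd₀ := hB _ hne₀
  simp only [mk3_t, mk3_y] at hbd₀
  set S := (range (d + 1)).filter (fun b => b + c ≤ d) with hS
  set f := MvPowerSeries.map ι f₀ with hf
  -- the column polynomial over `K₀` and over `K`
  set Φ₀ : Polynomial K₀ := ∑ b ∈ S, Polynomial.C (coeff (mk3 (d - b - c) b c) f₀) * Polynomial.X ^ b with hΦ₀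
  set Φ : Polynomial K := ∑ b ∈ S, Polynomial.C (coeff (mk3 (d - b - c) b c) f) * Polynomial.X ^ b with hΦ
  have hΦmap : Φ = Φ₀.map ι := by
    rw [hΦ, hΦ₀, Polynomial.map_sum]
    refine sum_congr rfl fun b _ => ?_
    rw [Polynomial.map_mul, Polynomial.map_C, Polynomial.map_pow, Polynomial.map_X, hf, MvPowerSeries.coeff_map]
  have hΦcoeff : ∀ n, Φ.coeff n = if n ∈ S then coeff (mk3 (d - n - c) n c) f else 0 := by
    intro n
    rw [hΦ, Polynomial.finsetSum_coeff]
    simp_rw [Polynomial.coeff_C_mul_X_pow]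
    rw [sum_ite_eq S n]
  have hb₀S : b₀ ∈ S := by rw [hS, mem_filter, mem_range]; omega
  have hΦne : Φ ≠ 0 := by
    intro h0
    have h1 := hΦcoeff b₀
    rw [h0, Polynomial.coeff_zero, if_pos hb₀S, show d - b₀ - c = a₀ by omega, hf, MvPowerSeries.coeff_map] at h1
    exact hne₀ ((map_eq_zero_iff ι ι.injective).mp h1.symm)
  have hΦ₀ne : Φ₀ ≠ 0 := fun h0 => hΦne (by rw [hΦmap, h0, Polynomial.map_zero])
  -- `X^{r_y} ∣ Φ` and `natDegree Φ ≤ d - c - r_t`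
  have hXry : Polynomial.X ^ ry ∣ Φ := by
    rw [hΦ]
    refine dvd_sum fun b hb => ?_
    by_cases h0 : coeff (mk3 (d - b - c) b c) f₀ = 0
    · rw [hf, MvPowerSeries.coeff_map, h0, map_zero, map_zero, zero_mul]; exact dvd_zero _
    · have h1 := (hB _ h0).2
      simp only [mk3_y] at h1
      exact dvd_mul_of_dvd_right (pow_dvd_pow _ h1) _
  have hdegΦ : Φ.natDegree ≤ d - c - rt := by
    rw [hΦ]
    refine Polynomial.natDegree_sum_le_of_forall_le _ _ fun b hb => ?_
    by_cases h0 : coeff (mk3 (d - b - c) b c) f₀ = 0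
    · rw [hf, MvPowerSeries.coeff_map, h0, map_zero, map_zero, zero_mul, Polynomial.natDegree_zero]; exact Nat.zero_le _
    · refine le_trans (Polynomial.natDegree_C_mul_X_pow_le _ _) ?_
      have h1 := (hB _ h0).1
      simp only [mk3_t] at h1
      rw [hS, mem_filter] at hb
      omega
  have hdegΦ₀ : Φ₀.natDegree = Φ.natDegree := by rw [hΦmap, Polynomial.natDegree_map]
  -- the multiplicity `k` of `l` and the nonzero Taylor coefficient
  set k := Polynomial.rootMultiplicity l Φ with hk
  have htay : (Polynomial.taylor l Φ).coeff k ≠ 0 := by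
    have h1 : k = (Polynomial.taylor l Φ).natTrailingDegree := by
      rw [hk, Polynomial.rootMultiplicity_eq_natTrailingDegree, Polynomial.taylor_apply]
    rw [h1]
    exact Polynomial.trailingCoeff_nonzero_iff_nonzero.mpr ((Polynomial.taylor_injective l).ne hΦne |> fun h => by rwa [map_zero] at h)
  -- `(π^ι)^k · X^{r_y} ∣ Φ`, so `m k + r_y ≤ natDegree Φ`
  have hπk : (π.map ι) ^ k ∣ Φ := by
    have h := pow_dvd_map_of_rootMultiplicity ι hirr hsep hl Φ₀.natDegree Φ₀ le_rfl
    rwa [← hΦmap] at h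
  have hcop : IsCoprime (Polynomial.X ^ ry : Polynomial K) ((π.map ι) ^ k) := by
    refine IsCoprime.pow ?_
    refine (Polynomial.irreducible_X.coprime_iff_not_dvd).mpr fun hX => ?_
    have h0 : (π.map ι).eval 0 = 0 := by
      obtain ⟨q, hq⟩ := hX; rw [hq, Polynomial.eval_mul, Polynomial.eval_X, zero_mul]
    have hXd : (Polynomial.X : Polynomial K₀) ∣ π := by
      rw [Polynomial.X_dvd_iff]
      have : ι (π.coeff 0) = 0 := by rwa [← Polynomial.coeff_zero_eq_eval_zero, Polynomial.coeff_map] at h0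
      exact (map_eq_zero_iff ι ι.injective).mp this
    obtain ⟨q, hq⟩ := hXd
    have hqu : IsUnit q := by
      rcases hirr.isUnit_or_isUnit hq with h | h
      · exact absurd h Polynomial.not_isUnit_X
      · exact h
    obtain ⟨c₁, hc₁⟩ := Polynomial.isUnit_iff.mp hqu
    have ht0 := hl.eq_zero
    rw [hq, ← hc₁.2, Polynomial.map_mul, Polynomial.map_X, Polynomial.map_C, Polynomial.eval_mul, Polynomial.eval_X, Polynomial.eval_C] at ht0
    rcases mul_eq_zero.mp ht0 with h | h
    · exact hl0 h
    · exact hc₁.1.ne_zero ((map_eq_zero_iff ι ι.injective).mp h)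
  have hprod : Polynomial.X ^ ry * (π.map ι) ^ k ∣ Φ := hcop.mul_dvd hXry hπk
  have hmk : π.natDegree * k + c ≤ d - rt - ry := by
    have h1 := Polynomial.natDegree_le_of_dvd hprod hΦne
    rw [Polynomial.natDegree_mul (pow_ne_zero _ Polynomial.X_ne_zero) (pow_ne_zero _ (Polynomial.map_ne_zero hirr.ne_zero)),
      Polynomial.natDegree_pow, Polynomial.natDegree_X, mul_one, Polynomial.natDegree_pow, Polynomial.natDegree_map] at h1
    have h2 : k * π.natDegree = π.natDegree * k := Nat.mul_comm _ _
    have h3 : rt + ry + c ≤ d := by omega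
    omega
  refine ⟨k, hmk, ?_⟩
  rw [coeff_stepT_layer hpd hd2 l γ ((lowVanish_map_iff ι d f₀).mpr hlow), layerP_eq_taylor_coeff, ← hS, ← hf, ← hΦ]
  exact htay

/-- **THE W-DEGREE LAW, shade form**: under (ND) (a `z`-free monomial of degree `d`), every `d′` with `LowVanish d′ (stepT p l γ f)` satisfies
`m · (d′ − (d − p)) ≤ σ = d − r_t − r_y` — the new shade (boundary `t^{d−p}`, no `y`-letter since `l ≠ 0`) is at most `σ / m`.
NOT a statement of the manuscript. [cite: Hauser2010, §§F–G (point blowup followed by cleaning)] -/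
theorem natDegree_mul_shade_le {p d rt ry : ℕ} (hpd : p + 1 ≤ d) (hd2 : d ≤ 2 * p - 1)
    {f₀ : MvPowerSeries (Option (Fin 2)) K₀} (hB : BDiv rt ry f₀) (hlow : LowVanish d f₀)
    {π : Polynomial K₀} (hirr : Irreducible π) (hsep : π.Separable) {l : K} (hl : (π.map ι).IsRoot l) (hl0 : l ≠ 0) (γ : K)
    (hnd : NDz d f₀) {d' : ℕ} (hlow' : LowVanish d' (stepT p l γ (MvPowerSeries.map ι f₀))) :
    π.natDegree * (d' - (d - p)) ≤ d - rt - ry := by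
  obtain ⟨a, b, hab, hne⟩ := hnd
  obtain ⟨k, hk, hcoef⟩ := exists_coeff_stepT_ne_zero_of_root ι hpd hd2 hB hlow hirr hsep hl hl0 γ (c := 0) ⟨a, b, by omega, hne⟩
  have hle : d' ≤ d - p + k := by
    by_contra hlt
    push Not at hlt
    exact hcoef (hlow' _ (by rw [degree_mk3]; omega))
  calc π.natDegree * (d' - (d - p)) ≤ π.natDegree * k := Nat.mul_le_mul_left _ (by omega)
    _ ≤ d - rt - ry := by omega

end DegreeLaw

/-! ## §3 One-variable algebra of defect persistence -/

section Persistence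

variable {K : Type*} [Field K]

/-- **A column with vanishing low Taylor coefficients and vanishing top coefficient is zero**: `Φ = Σ_{b ∈ S} a_b X^b`, every `b ∈ S` with
`a_b ≠ 0` at most `N`, the Taylor coefficients at `l` of index `< N` zero, and `a_N = 0` (if `N ∈ S`) ⟹ all `a_b = 0`
(`taylor l Φ` has degree `≤ N` and top coefficient `a_N`). [folklore] -/
theorem eq_zero_of_taylor_coeff_eq_zero (S : Finset ℕ) (a : ℕ → K) (N : ℕ) (l : K) (hdeg : ∀ b ∈ S, a b ≠ 0 → b ≤ N)
    (htay : ∀ i, i < N → ∑ b ∈ S, a b * (((b.choose i : ℕ) : K) * l ^ (b - i)) = 0) (htop : ∀ b ∈ S, b = N → a b = 0) :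
    ∀ b ∈ S, a b = 0 := by
  classical
  set Φ : Polynomial K := ∑ b ∈ S, Polynomial.C (a b) * Polynomial.X ^ b with hΦ
  have hΦcoeff : ∀ n, Φ.coeff n = if n ∈ S then a n else 0 := by
    intro n
    rw [hΦ, Polynomial.finsetSum_coeff]
    simp_rw [Polynomial.coeff_C_mul_X_pow]
    rw [sum_ite_eq S n]
  have hdegΦ : Φ.natDegree ≤ N := by
    rw [hΦ]
    refine Polynomial.natDegree_sum_le_of_forall_le _ _ fun b hb => ?_
    by_cases h0 : a b = 0
    · rw [h0, map_zero, zero_mul, Polynomial.natDegree_zero]; exact Nat.zero_le _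
    · exact le_trans (Polynomial.natDegree_C_mul_X_pow_le _ _) (hdeg b hb h0)
  -- all coefficients of `taylor l Φ` vanish
  have hT : Polynomial.taylor l Φ = 0 := by
    refine Polynomial.ext fun i => ?_
    rw [Polynomial.coeff_zero]
    rcases lt_trichotomy i N with hlt | heq | hgt
    · rw [hΦ, taylor_coeff_sum_C_mul_X_pow]; exact htay i hlt
    · subst heq
      rw [hΦ, taylor_coeff_sum_C_mul_X_pow]
      refine sum_eq_zero fun b hb => ?_
      by_cases h0 : a b = 0
      · rw [h0, zero_mul]
      · have hbN := hdeg b hb h0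
        rcases hbN.lt_or_eq with hlt' | heq'
        · rw [Nat.choose_eq_zero_of_lt hlt', Nat.cast_zero, zero_mul, mul_zero]
        · exact absurd (htop b hb heq') h0
    · refine Polynomial.coeff_eq_zero_of_natDegree_lt ?_
      rw [Polynomial.natDegree_taylor]; omega
  have hΦ0 : Φ = 0 := (Polynomial.taylor_injective l) (by rw [hT, map_zero])
  intro b hb
  have h1 := hΦcoeff b
  rw [hΦ0, Polynomial.coeff_zero, if_pos hb] at h1
  exact h1.symm

/-- `pcoef` with no `y`-letter as a Taylor sum over the column `z^c` of the degree-`d` layer. [folklore] -/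
theorem pcoef_zero_eq_sum (d : ℕ) (l : K) (f : MvPowerSeries (Option (Fin 2)) K) (i c : ℕ) :
    pcoef 0 d l f i c = ∑ b ∈ (range (d + 1)).filter (fun b => b + c ≤ d),
      coeff (mk3 (d - b - c) b c) f * (((b.choose i : ℕ) : K) * l ^ (b - i)) := by
  rw [pcoef, sum_filter]
  refine sum_congr rfl fun b _ => ?_
  simp only [Nat.zero_add, Nat.add_zero, Nat.sub_zero]
  split_ifs
  · ring
  · rfl

/-- **DEFECT PERSISTENCE, coefficient form.** Let `f` have `LowVanish d f`, `BDiv r 0 f` with `r = d − p ≥ 1`, `p + 1 ≤ d ≤ 2p − 1`, and suppose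
(i) the `t^r`-layer of `f` in degree `d` has no monomial of `z`-exponent `< p` (`coeff (mk3 r b c) f = 0` for `b + c = p`, `c < p`), and
(ii) the next step STALLS: `LowVanish d (stepT p l γ f)` (new order again `d = (d − p) + p`). Then the WHOLE degree-`d` form of `f` has no
monomial of `z`-exponent `< p`. (pv-5's `pcoef_eq_zero_of_stall` kills the Taylor coefficients of the column `Φ_c` below `p − c`; its degree is
`≤ p − c` and its top coefficient sits on the `t^r`-layer.) [cite: Hauser2010, §F] -/
theorem coeff_eq_zero_of_layer_of_stall {p d : ℕ} (hpd : p + 1 ≤ d) (hd2 : d ≤ 2 * p - 1) {f : MvPowerSeries (Option (Fin 2)) K}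
    (hlow : LowVanish d f) (hB : BDiv (d - p) 0 f) (hlayer : ∀ b c, b + c = p → c < p → coeff (mk3 (d - p) b c) f = 0) {l γ : K}
    (hstall : LowVanish d (stepT p l γ f)) {a b c : ℕ} (habc : a + b + c = d) (hc : c < p) : coeff (mk3 a b c) f = 0 := by
  classical
  by_contra hne
  have hbd := hB _ hne
  simp only [mk3_t] at hbd
  set S := (range (d + 1)).filter (fun b => b + c ≤ d) with hS
  have key := eq_zero_of_taylor_coeff_eq_zero S (fun b => coeff (mk3 (d - b - c) b c) f) (p - c) l ?_ ?_ ?_ b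
    (by rw [hS, mem_filter, mem_range]; omega)
  · rw [show d - b - c = a by omega] at key
    exact hne key
  · -- degrees: a nonzero coefficient has `t`-exponent `≥ d - p`
    intro b' hb' hne'
    have h1 := (hB _ hne').1
    simp only [mk3_t] at h1
    rw [hS, mem_filter] at hb'
    omega
  · -- the Taylor coefficients below `p - c` vanish by the stall
    intro i hi
    rw [← pcoef_zero_eq_sum]
    exact pcoef_eq_zero_of_stall hpd hd2 hlow hB (Or.inr rfl) (by rw [show d - p + (d - (d - p) - 0) = d by omega]; exact hstall)
      (by omega)
  · -- the top coefficient is on the `t^{d-p}`-layer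
    intro b' hb' hb'N
    rw [show d - b' - c = d - p by omega]
    exact hlayer b' c (by omega) hc

end Persistence

end WWalkNR

end CampaignW46

end Summit.ResolutionOfSingularities.ResolutionOfSingularities.Theorems

end
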